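import Summits.AtomisticToContinuum.HydrodynamicLimit.Theorems.OneFlightGossipEngineEquilibriumClampedCollisionalWindowLDRadialVirialDefs

/-!
# Record algebra of the line `radial-virial-polarization` (crux `EquilibriumClampedCollisionalWindowLD`, stmt-AtomisticToContinuum-13733)

Pathwise / per-record identities consumed by the composition (`…RadialVirialAssembly`):

* `collisionSum_congr_contact` — record functionals agreeing on records read off CONTACT pairs have equal collision sums;
  `sum_sq_impactVec_eq_one` — contact records carry unit impact vectors;
* the POLARISATION SPLIT of the radial-virial weights delivered by `stub_collisionDecomposition`: `gamM_split`
  (`⟨∇φ,ω̂⟩ω̂_k = ⅓∂_kφ + ⟨ω̂, S°_k ω̂⟩`, `S°_k = Sym(∇φ⊗e_k) − ⅓∂_kφ·I` traceless) and `gamE_split`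
  (`⟨∇φ,ω̂⟩⟨V_cm,ω̂⟩ = ⅓⟨∇φ,u₀⟩ + ⟨ω̂,S°_e ω̂⟩ + ⟨ω̂,∇φ⟩⟨V_cm − u₀,ω̂⟩`), hence `Rvir_gamM`, `Rvir_gamE` (every datum);
* linearity of the clamped radial virial in the weight on good orbits (`Rvir_lin/_add/_sub`, `virN_add/_sub`: honest finite sums,
  `HardSphereFlow.finite_collisionTimes_inter`), and the positive/negative parts `pp`, `np` of a weight.

prover-line-stmt-AtomisticToContinuum-13733-c2-0, 2026-08-16.
-/

noncomputable section

open MeasureTheory Set Filter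
open scoped ENNReal BigOperators
open Literature.Analysis.FluidPDE Literature.MathematicalPhysics.KineticTheory
open Literature.Analysis.FunctionSpaces (Torus.partialDeriv Torus.IsSmooth)

namespace Summit.AtomisticToContinuum.HydrodynamicLimit.Theorems.ClampedTransferCoin

namespace RadialVirial

/-! ### Record algebra: congruence on contact records, unit impact vectors, the polarisation split -/

section Algebra

variable {σ τ V : ℝ} {N : ℕ}

/-- Two record functionals that agree on every record read off a contact pair have the same collision sum. -/
theorem collisionSum_congr_contact (Φ : Flow σ N) (S : Set ℝ) {F F' : Rec N → ℝ}
    (h : ∀ (t : ℝ) (x : Phase N) (p : Fin (N + 1) × Fin (N + 1)),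
      p ∈ contactPairs (Torus.geometry (Fin 3)) (hsDiameter σ N) x →
        F (HardSphereCollisionRecord.ofConfig (Torus.geometry (Fin 3)) (hsDiameter σ N) x t p.1 p.2) =
          F' (HardSphereCollisionRecord.ofConfig (Torus.geometry (Fin 3)) (hsDiameter σ N) x t p.1 p.2))
    (z : Phase N) : Φ.collisionSum S F z = Φ.collisionSum S F' z := by
  simp only [HardSphereFlow.collisionSum_eq, Literature.Analysis.FluidPDE.collisionSum,
    Literature.Analysis.FluidPDE.collisionPairSum]
  exact finsum_congr fun t => finsum_congr fun _ => Finset.sum_congr rfl fun p hp => h t _ p hp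

/-- The diameter is positive. -/
theorem hsDiameter_pos' (hσ : 0 < σ) (N : ℕ) : 0 < hsDiameter σ N := by
  unfold hsDiameter; positivity

/-- On a contact record the impact vector is a unit vector: `Σ_a ω̂_a² = 1`. -/
theorem sum_sq_impactVec_eq_one (hσ : 0 < σ) {x : Phase N} {t : ℝ} {p : Fin (N + 1) × Fin (N + 1)}
    (hp : p ∈ contactPairs (Torus.geometry (Fin 3)) (hsDiameter σ N) x) :
    ∑ a, (HardSphereCollisionRecord.ofConfig (Torus.geometry (Fin 3)) (hsDiameter σ N) x t p.1 p.2).impactVec a *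
      (HardSphereCollisionRecord.ofConfig (Torus.geometry (Fin 3)) (hsDiameter σ N) x t p.1 p.2).impactVec a = 1 := by
  have hn := HardSphereCollisionRecord.norm_ofConfig_impactVec (hsDiameter_pos' hσ N) t (mem_contactPairs.1 hp).2
  set ω := (HardSphereCollisionRecord.ofConfig (Torus.geometry (Fin 3)) (hsDiameter σ N) x t p.1 p.2).impactVec
  have h2 : ‖ω‖ ^ 2 = ∑ a, ‖ω a‖ ^ 2 := EuclideanSpace.norm_sq_eq ω
  rw [hn, one_pow] at h2
  rw [h2]
  refine Finset.sum_congr rfl fun a _ => ?_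
  rw [Real.norm_eq_abs, sq_abs, sq]

/-- `Σ_a ω_a e_k(a) = ω_k`. -/
theorem sum_mul_single (ω : Fin 3 → ℝ) (k : Fin 3) : ∑ a, ω a * (Pi.single k (1 : ℝ) : Fin 3 → ℝ) a = ω k := by
  simp only [Pi.single_apply, mul_ite, mul_one, mul_zero, Finset.sum_ite_eq', Finset.mem_univ, if_true]

/-- The quadratic form of a symmetrised outer product factorises: `⟨ω, Sym(g⊗e) ω⟩ = ⟨ω,g⟩⟨ω,e⟩`. -/
theorem quadForm_symOuter (ω g e : Fin 3 → ℝ) :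
    ∑ a, ∑ b, ω a * symOuter g e a b * ω b = (∑ a, ω a * g a) * (∑ a, ω a * e a) := by
  simp only [symOuter, Fin.sum_univ_three]
  ring

/-- The quadratic form of `p · I` is `p Σ ω_a²`. -/
theorem quadForm_diag (ω : Fin 3 → ℝ) (p : ℝ) :
    ∑ a, ∑ b, ω a * (if a = b then p else 0) * ω b = p * ∑ a, ω a * ω a := by
  simp only [Fin.sum_univ_three, Fin.isValue]
  simp only [Fin.isValue, ↓reduceIte, Fin.reduceEq]
  ring

/-- The quadratic-form weight of `S − pI`. -/
theorem quadWeight_sub_diag (S : T3 → Fin 3 → Fin 3 → ℝ) (p : T3 → ℝ) (c : Rec N) :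
    quadWeight (fun x a b => S x a b - if a = b then p x else 0) c =
      quadWeight S c - p c.fstPos * ∑ a, c.impactVec a * c.impactVec a := by
  unfold quadWeight
  rw [← quadForm_diag]
  rw [← Finset.sum_sub_distrib]
  refine Finset.sum_congr rfl fun a _ => ?_
  rw [← Finset.sum_sub_distrib]
  refine Finset.sum_congr rfl fun b _ => ?_
  ring

/-- **Polarisation split, momentum row** (unit `ω̂`): `Γ_k = ψ_k(x_fst) + ⟨ω̂, S°_k ω̂⟩`. -/
theorem gamM_split (φ : T3 → ℝ) (k : Fin 3) (c : Rec N) (hω : ∑ a, c.impactVec a * c.impactVec a = 1) :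
    gamM φ k c = psiM φ k c.fstPos + quadWeight (devM φ k) c := by
  have h1 : quadWeight (devM φ k) c =
      quadWeight (fun x a b => symOuter (fun l => Torus.partialDeriv l φ x) (Pi.single k 1) a b) c -
        psiM φ k c.fstPos * ∑ a, c.impactVec a * c.impactVec a :=
    quadWeight_sub_diag _ _ c
  have h2 : quadWeight (fun x a b => symOuter (fun l => Torus.partialDeriv l φ x) (Pi.single k 1) a b) c =
      (∑ a, c.impactVec a * Torus.partialDeriv a φ c.fstPos) * c.impactVec k := by
    unfold quadWeight
    rw [quadForm_symOuter, sum_mul_single]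
  have h3 : (∑ a, c.impactVec a * Torus.partialDeriv a φ c.fstPos) =
      ∑ l, Torus.partialDeriv l φ c.fstPos * c.impactVec l :=
    Finset.sum_congr rfl fun a _ => mul_comm _ _
  rw [h1, h2, hω, h3, gamM]
  ring

/-- **Polarisation split, energy row** (unit `ω̂`): `Γ_e = ψ_e(x_fst) + ⟨ω̂, S°_e ω̂⟩ + ⟨ω̂,∇φ⟩⟨V_cm − u₀, ω̂⟩`. -/
theorem gamE_split (u₀ : V3) (φ : T3 → ℝ) (c : Rec N) (hω : ∑ a, c.impactVec a * c.impactVec a = 1) :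
    gamE φ c = psiE u₀ φ c.fstPos + quadWeight (devE u₀ φ) c + thermalWeight u₀ (gradF φ) c := by
  have h1 : quadWeight (devE u₀ φ) c =
      quadWeight (fun x a b => symOuter (fun l => Torus.partialDeriv l φ x) (fun l => u₀ l) a b) c -
        psiE u₀ φ c.fstPos * ∑ a, c.impactVec a * c.impactVec a :=
    quadWeight_sub_diag _ _ c
  have h2 : quadWeight (fun x a b => symOuter (fun l => Torus.partialDeriv l φ x) (fun l => u₀ l) a b) c =
      (∑ a, c.impactVec a * Torus.partialDeriv a φ c.fstPos) * (∑ a, c.impactVec a * u₀ a) := by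
    unfold quadWeight
    rw [quadForm_symOuter]
  have h3 : (∑ a, c.impactVec a * Torus.partialDeriv a φ c.fstPos) =
      ∑ l, Torus.partialDeriv l φ c.fstPos * c.impactVec l :=
    Finset.sum_congr rfl fun a _ => mul_comm _ _
  have h4 : thermalWeight u₀ (gradF φ) c =
      (∑ l, Torus.partialDeriv l φ c.fstPos * c.impactVec l) *
        ((∑ l, ((2 : ℝ)⁻¹ • (c.postVel.1 + c.postVel.2)) l * c.impactVec l) - ∑ a, c.impactVec a * u₀ a) := by
    unfold thermalWeight gradF
    congr 1
    rw [← Finset.sum_sub_distrib]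
    refine Finset.sum_congr rfl fun l _ => ?_
    ring
  rw [h1, h2, hω, h3, h4, gamE]
  ring

/-- On a good orbit the window carries finitely many collision times. -/
theorem finite_collisionTimes_window (Φ : Flow σ N) {z : Phase N} (hz : z ∈ Φ.good) (τ : ℝ) :
    (collisionTimes (Torus.geometry (Fin 3)) (hsDiameter σ N) (fun t => Φ.flow t z) ∩
      Set.Ioc 0 (window τ N)).Finite :=
  Φ.finite_collisionTimes_inter hz Set.Ioc_subset_Icc_self

/-- **Linearity of the clamped radial virial in the weight** (good orbits: an honest finite sum). -/
theorem Rvir_lin (Φ : Flow σ N) {z : Phase N} (hz : z ∈ Φ.good) (a b : ℝ) (Γ₁ Γ₂ : Rec N → ℝ) :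
    Rvir σ τ V Φ (fun c => a * Γ₁ c + b * Γ₂ c) z = a * Rvir σ τ V Φ Γ₁ z + b * Rvir σ τ V Φ Γ₂ z := by
  have hfin := finite_collisionTimes_window Φ hz τ
  simp only [Rvir, HardSphereFlow.collisionSum_eq, collisionSum_eq_finset_sum hfin, Finset.mul_sum,
    ← Finset.sum_add_distrib]
  refine Finset.sum_congr rfl fun t _ => Finset.sum_congr rfl fun p _ => ?_
  ring

/-- Additivity of the clamped radial virial in the weight (good orbits). -/
theorem Rvir_add (Φ : Flow σ N) {z : Phase N} (hz : z ∈ Φ.good) (Γ₁ Γ₂ : Rec N → ℝ) :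
    Rvir σ τ V Φ (fun c => Γ₁ c + Γ₂ c) z = Rvir σ τ V Φ Γ₁ z + Rvir σ τ V Φ Γ₂ z := by
  have h := Rvir_lin (τ := τ) (V := V) Φ hz 1 1 Γ₁ Γ₂
  simp only [one_mul] at h
  exact h

/-- The clamped radial virial of a difference of weights (good orbits). -/
theorem Rvir_sub (Φ : Flow σ N) {z : Phase N} (hz : z ∈ Φ.good) (Γ₁ Γ₂ : Rec N → ℝ) :
    Rvir σ τ V Φ (fun c => Γ₁ c - Γ₂ c) z = Rvir σ τ V Φ Γ₁ z - Rvir σ τ V Φ Γ₂ z := by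
  have h := Rvir_lin (τ := τ) (V := V) Φ hz 1 (-1) Γ₁ Γ₂
  simp only [one_mul, neg_one_mul, ← sub_eq_add_neg] at h
  exact h

/-- Additivity of the normalised radial virial in the weight (good orbits). -/
theorem virN_add (Φ : Flow σ N) {z : Phase N} (hz : z ∈ Φ.good) (Γ₁ Γ₂ : Rec N → ℝ) :
    virN σ τ V Φ (fun c => Γ₁ c + Γ₂ c) z = virN σ τ V Φ Γ₁ z + virN σ τ V Φ Γ₂ z := by
  simp only [virN, Rvir_add Φ hz]; ring

/-- The normalised radial virial of a difference of weights (good orbits). -/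
theorem virN_sub (Φ : Flow σ N) {z : Phase N} (hz : z ∈ Φ.good) (Γ₁ Γ₂ : Rec N → ℝ) :
    virN σ τ V Φ (fun c => Γ₁ c - Γ₂ c) z = virN σ τ V Φ Γ₁ z - virN σ τ V Φ Γ₂ z := by
  simp only [virN, Rvir_sub Φ hz]; ring

/-- The radial virial of S5's momentum weight splits into isotropic and traceless parts (every `z`: contact records have
unit impact vectors). -/
theorem Rvir_gamM (hσ : 0 < σ) (Φ : Flow σ N) (φ : T3 → ℝ) (k : Fin 3) (z : Phase N) :
    Rvir σ τ V Φ (gamM φ k) z = Rvir σ τ V Φ (fun c => psiM φ k c.fstPos + quadWeight (devM φ k) c) z := by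
  unfold Rvir
  refine collisionSum_congr_contact Φ _ (fun t x p hp => ?_) z
  rw [gamM_split φ k _ (sum_sq_impactVec_eq_one hσ hp)]

/-- The radial virial of S5's energy weight splits into isotropic, traceless and thermal parts (every `z`). -/
theorem Rvir_gamE (hσ : 0 < σ) (Φ : Flow σ N) (u₀ : V3) (φ : T3 → ℝ) (z : Phase N) :
    Rvir σ τ V Φ (gamE φ) z =
      Rvir σ τ V Φ (fun c => psiE u₀ φ c.fstPos + quadWeight (devE u₀ φ) c + thermalWeight u₀ (gradF φ) c) z := by
  unfold Rvir
  refine collisionSum_congr_contact Φ _ (fun t x p hp => ?_) z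
  rw [gamE_split u₀ φ _ (sum_sq_impactVec_eq_one hσ hp)]

/-- Positive / negative parts of a weight. -/
def pp (ψ : T3 → ℝ) (x : T3) : ℝ := max (ψ x) 0

/-- Negative part of a weight. -/
def np (ψ : T3 → ℝ) (x : T3) : ℝ := max (-ψ x) 0

/-- The positive part is nonnegative. -/
theorem pp_nonneg (ψ : T3 → ℝ) (x : T3) : 0 ≤ pp ψ x := le_max_right _ _
/-- The negative part is nonnegative. -/
theorem np_nonneg (ψ : T3 → ℝ) (x : T3) : 0 ≤ np ψ x := le_max_right _ _
/-- `ψ = ψ⁺ − ψ⁻`. -/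
theorem pp_sub_np (ψ : T3 → ℝ) (x : T3) : pp ψ x - np ψ x = ψ x := max_zero_sub_max_neg_zero_eq_self (ψ x)
/-- The positive part of a continuous weight is continuous. -/
theorem continuous_pp {ψ : T3 → ℝ} (h : Continuous ψ) : Continuous (pp ψ) := h.max continuous_const
/-- The negative part of a continuous weight is continuous. -/
theorem continuous_np {ψ : T3 → ℝ} (h : Continuous ψ) : Continuous (np ψ) := h.neg.max continuous_const

/-- Registered anchor of this file (= `quadForm_symOuter`). -/
theorem radialVirialAlgebra_quadForm_symOuter (ω g e : Fin 3 → ℝ) : ∑ a, ∑ b, ω a * symOuter g e a b * ω b = (∑ a, ω a * g a) * (∑ a, ω a * e a) :=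
  quadForm_symOuter ω g e

end Algebra

end RadialVirial

end Summit.AtomisticToContinuum.HydrodynamicLimit.Theorems.ClampedTransferCoin

end
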